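import Literature.NumberTheory.NumberFields.EquivariantIwasawaLemmaClassGroup
import Literature.NumberTheory.GaloisRepresentations.RamificationFiltration
import HarnessLib

/-!
# The equivariant Iwasawa lemma, IV: absolute form (subfields of `k̄`, `Γ_k`-modules) and the tower

Topic `NumberTheory/NumberFields` (namespace = path, grouping sub-namespace `EquivariantIwasawaLemma`).
THEOREM-ONLY file (no definition, no named fact, no `sorry`), written by the literature seat
`bsd-potss-conjA-anchor` g16 (cell `bsd-potss`; serves stmt-BirchSwinnertonDyer-19386 / 19413; closes
nothing; neither Conjecture A nor BSD is proved for any curve here).  Sequel of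
`EquivariantIwasawaLemmaClassGroup.lean`: the same lemma, restated in the vocabulary in which the tree's
consumers work (`Literature/NumberTheory/EllipticCurves/FineSelmerClassGroupCriterion*.lean`,
`ZpExtension.layer`): the fields are finite Galois subextensions `B ≤ F` of `k̄ = AlgebraicClosure k`
(`IntermediateField k k̄`), the group is the absolute Galois group `Γ_k = Field.absoluteGaloisGroup k`
acting on ideals and ideal classes of `F` through the restriction `absRestrictNormalHom F : Γ_k → Gal(F/k)`
and the tree's `AmbiguousClass.intAut`, and `V` is any `p`-torsion `Γ_k`-module on which `Γ_B` acts
trivially.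

## Results

* **`equivariantHom_classGroup_eq_zero_of_cyclic_layer_absolute`** — `B ≤ F ≤ k̄` finite Galois over the
  number field `k`, `[F : k] = p · [B : k]` with `p` odd, `Gal(F/B)` central in `Gal(F/k)` (as
  `σ|_B = 1 ⟹ (στ)|_F = (τσ)|_F`), `V` a `p`-torsion `Γ_k`-module with `Γ_B` acting trivially,
  (c2*) `Hom_{Γ_k}(Cl(B), V) = 0`, (c3*) `V^{D_𝔓} = 0` for every prime `𝔓` of `F` ramified in `F/B`
  ("ramified" = some `σ ∈ Γ_k` with `σ|_F` in the inertia group of `𝔓`, `σ|_F ≠ 1`, `σ|_B = 1`), and one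
  such prime with a number of `Gal(F/k)`-conjugates prime to `p` ⟹ `Hom_{Γ_k}(Cl(F), V) = 0`.
  PROOF: transport of `equivariantHom_classGroup_eq_zero_of_cyclic_layer_of_classGroup` (file III) along
  `B ≃ₐ[k] IntermediateField.restrict (B ≤ F)` (Mathlib), with `#I(𝔓) = e(𝔓 | B)` (tree
  `card_inertia_eq_ramificationIdx`) and `F/B` unramified at infinity in odd degree (Mathlib).
* `equivariant_iff_forall_mk0` — the equivariance condition `f(τ · c) = τ • f(c)` on classes
  (`ClassGroup.mulEquiv (intAut τ|_F)`) is the condition `f[J] = τ • f[I]` whenever `J = τ|_F (I)` on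
  integral ideals used in `FineSelmerClassGroupCriterionTorsionPointFieldEigen.lean`.
* **`equivariantHom_classGroup_eq_zero_tower`** — induction along a tower `L₀ ≤ L₁ ≤ ⋯ ≤ k̄` of such
  layers: (c2*) for `L₀` ⟹ `Hom_{Γ_k}(Cl(L_n), V) = 0` for every `n`; and
  `equivariantHom_classGroup_eq_zero_tower_of_not_dvd_card` — the same from `p ∤ h(L₀)`.
  For `k = ℚ`, `L_n = ℚ(E[p])ℚ_n` the layers of the cyclotomic `ℤ_p`-extension over the `p`-division
  field of an elliptic curve with `p ∤ #Gal(ℚ(E[p])/ℚ)` and `V = E[p]`, (c3*) is `E(ℚ_p)[p] = 0` and the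
  conclusion is «the `E[p]`-part of `Cl(L_n) ⊗ 𝔽_p` is zero for all `n`» (door L6 of the cell's census);
  the verification of the layer hypotheses for that tower is not done here.

## References

* L. C. Washington, *Introduction to Cyclotomic Fields*, 2nd ed., GTM 83 (1997), §13.3 Lemmas 13.14–13.15,
  Thm. 10.4. [Washington1997]
* J. Neukirch, *Algebraic Number Theory* (1999), Ch. VI (6.9), (7.1); Ch. IV §6; Ch. I §9. [NeukirchANT1999]
-/

noncomputable section

open scoped Pointwise nonZeroDivisors
open NumberField Field IntermediateField Ideal
open Literature.NumberTheory.GaloisRepresentations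

namespace Literature.NumberTheory.NumberFields

namespace EquivariantIwasawaLemma

section Absolute

variable {k : Type} [Field k]

/-! ### Helpers: restriction from `Γ_k`, transport of classes along a ring isomorphism -/

/-- Restriction `Γ_k → Gal(E/k)` is onto (Mathlib `AlgEquiv.restrictNormalHom_surjective`). [folklore] -/
private theorem absRestrictNormalHom_surjective' (E : IntermediateField k (AlgebraicClosure k))
    [Normal k E] : Function.Surjective (absRestrictNormalHom E) := fun g => by
  obtain ⟨σ, hσ⟩ := AlgEquiv.restrictNormalHom_surjective (AlgebraicClosure k) g
  exact ⟨(Field.absoluteGaloisGroup.toAlgEquiv k).symm σ, hσ⟩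

/-- `((τ|_E) x : k̄) = τ • x`. [folklore] -/
private theorem coe_absRestrictNormalHom_apply' (E : IntermediateField k (AlgebraicClosure k))
    [Normal k E] (τ : absoluteGaloisGroup k) (x : E) :
    ((absRestrictNormalHom E τ x : E) : AlgebraicClosure k) = τ • (x : AlgebraicClosure k) :=
  AlgEquiv.restrictNormalHom_apply E _ x

/-- `τ|_E = 1` iff `τ` fixes `E ⊆ k̄` pointwise. [folklore] -/
private theorem absRestrictNormalHom_eq_one_iff' (E : IntermediateField k (AlgebraicClosure k))
    [Normal k E] (τ : absoluteGaloisGroup k) :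
    absRestrictNormalHom E τ = 1 ↔ ∀ x : E, τ • (x : AlgebraicClosure k) = x := by
  constructor
  · intro h x
    rw [← coe_absRestrictNormalHom_apply' E τ x, h, AlgEquiv.one_apply]
  · intro h
    ext x
    rw [coe_absRestrictNormalHom_apply' E τ x, AlgEquiv.one_apply]
    exact h x

/-- If `τ` is trivial on `E'` then it is trivial on every `E ≤ E'`. [folklore] -/
private theorem absRestrictNormalHom_eq_one_of_le {E E' : IntermediateField k (AlgebraicClosure k)}
    [Normal k E] [Normal k E'] (h : E ≤ E') (τ : absoluteGaloisGroup k)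
    (hτ : absRestrictNormalHom E' τ = 1) : absRestrictNormalHom E τ = 1 := by
  rw [absRestrictNormalHom_eq_one_iff'] at hτ ⊢
  exact fun x => hτ ⟨x, h x.2⟩

/-- A ring isomorphism maps non-zero ideals to non-zero ideals. [folklore] -/
private theorem map_mem_nonZeroDivisors' {R S : Type*} [CommRing R] [IsDomain R] [CommRing S]
    [IsDomain S] (g : R ≃+* S) (J : (Ideal R)⁰) : (J : Ideal R).map (g : R →+* S) ∈ (Ideal S)⁰ := by
  rw [mem_nonZeroDivisors_iff_ne_zero]
  intro h
  exact nonZeroDivisors.ne_zero J.2 ((Ideal.map_eq_bot_iff_of_injective g.injective).mp h)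

/-- `ClassGroup.mulEquiv g` on the class of an integral ideal `J` is the class of `g(J)` (the general
form of the tree's `AmbiguousClass.mulEquiv_mk0`). [folklore] -/
private theorem mulEquiv_mk0' {R S : Type*} [CommRing R] [IsDedekindDomain R] [CommRing S]
    [IsDedekindDomain S] (g : R ≃+* S) (J : (Ideal R)⁰) :
    ClassGroup.mulEquiv g (ClassGroup.mk0 J) =
      ClassGroup.mk0 ⟨_, map_mem_nonZeroDivisors' g J⟩ := by
  have hmk : ∀ I : (FractionalIdeal R⁰ (FractionRing R))ˣ,
      ClassGroup.mulEquiv g (ClassGroup.mk (FractionRing R) I) =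
        ClassGroup.mk (FractionRing S) (Units.mapEquiv
          (FractionalIdeal.ringEquivOfRingEquiv (FractionRing R) (FractionRing S) g).toMulEquiv I) :=
    fun I => by
    rw [ClassGroup.mulEquiv, MulEquiv.trans_apply, MulEquiv.trans_apply, ClassGroup.equiv_mk,
      MulEquiv.symm_apply_eq, ClassGroup.equiv_mk, QuotientGroup.congr_mk']
    congr 1
    ext1
    simp [FractionalIdeal.canonicalEquiv_self]
  rw [← ClassGroup.mk_mk0 (FractionRing R) J, hmk, ← ClassGroup.mk_mk0 (FractionRing S)]
  congr 1
  ext1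
  rw [Units.coe_mapEquiv, FractionalIdeal.coe_mk0, FractionalIdeal.coe_mk0]
  exact AmbiguousClass.ringEquivOfRingEquiv_coeIdeal _ _ g J

/-! ### Equivariance on classes versus on integral ideals -/

/-- **The two forms of `Γ`-equivariance agree.**  For a number field `L`, a Galois action through
`ρ : Γ → Aut(L/K)` and an additive `f : Cl(𝓞_L) → V`: `f(ρ(τ) · c) = τ • f(c)` for all classes `c`
(`ClassGroup.mulEquiv (intAut (ρ τ))`, the action of the tree's `AmbiguousClassGaloisAction.lean`) iff
`f[J] = τ • f[I]` for all non-zero integral ideals with `J = ρ(τ)(I)` (the form used in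
`FineSelmerClassGroupCriterionTorsionPointFieldEigen.lean`); by `AmbiguousClass.mulEquiv_mk0` and
`ClassGroup.mk0_surjective`. [cite: NeukirchANT1999, Ch. I §9 (Galois action on ideals) and Ch. IV §6] -/
theorem equivariant_iff_forall_mk0 {K L : Type*} [Field K] [Field L] [NumberField L] [Algebra K L]
    {Γ : Type*} [Group Γ] (ρ : Γ →* (L ≃ₐ[K] L))
    {V : Type*} [AddCommGroup V] [DistribMulAction Γ V] (f : Additive (ClassGroup (𝓞 L)) →+ V) :
    (∀ (τ : Γ) (c : ClassGroup (𝓞 L)),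
      f (Additive.ofMul (ClassGroup.mulEquiv (AmbiguousClass.intAut (ρ τ)) c)) =
        τ • f (Additive.ofMul c)) ↔
    (∀ (τ : Γ) (I J : (Ideal (𝓞 L))⁰),
      (J : Ideal (𝓞 L)) = (I : Ideal (𝓞 L)).map (AmbiguousClass.intAut (ρ τ) : 𝓞 L →+* 𝓞 L) →
      f (Additive.ofMul (ClassGroup.mk0 J)) = τ • f (Additive.ofMul (ClassGroup.mk0 I))) := by
  constructor
  · intro h τ I J hIJ
    have hJ : J = ⟨_, AmbiguousClass.map_mem_nonZeroDivisors (ρ τ) I⟩ := Subtype.ext hIJ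
    rw [hJ, ← AmbiguousClass.mulEquiv_mk0 (ρ τ) I]
    exact h τ _
  · intro h τ c
    obtain ⟨I, rfl⟩ := ClassGroup.mk0_surjective c
    rw [AmbiguousClass.mulEquiv_mk0 (ρ τ) I]
    exact h τ I _ rfl

/-! ### The lemma for subfields of `k̄` -/

variable [NumberField k]

set_option maxHeartbeats 400000 in
/-- **The equivariant Iwasawa lemma, absolute form.**  `k` a number field, `B ≤ F` finite Galois
subextensions of `k̄/k` with `[F : k] = p · [B : k]`, `p` an odd prime, such that `Gal(F/B)` is central
in `Gal(F/k)` (`σ|_B = 1 ⟹ (στ)|_F = (τσ)|_F` for `σ, τ ∈ Γ_k`); `V` a `p`-torsion `Γ_k`-module on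
which `Γ_B = {τ : τ|_B = 1}` acts trivially.  Assume (c2*) every additive `Γ_k`-equivariant
`μ : Cl(𝓞_B) → V` is zero; (c3*) for every prime `𝔓` of `F` ramified in `F/B` — i.e. some `σ ∈ Γ_k`
has `σ|_F` in the inertia group of `𝔓`, `σ|_F ≠ 1` and `σ|_B = 1` — the decomposition group
`{τ ∈ Γ_k : τ|_F 𝔓 = 𝔓}` has no non-zero fixed vector on `V`; and some such ramified prime `𝔓₀` has a
number `[Gal(F/k) : Stab(𝔓₀)]` of conjugates prime to `p`.  Then every additive `Γ_k`-equivariant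
`f : Cl(𝓞_F) → V` is zero.  (Washington's `p ∤ h` lemma, §13.3 L. 13.14–13.15 / Thm. 10.4, made
equivariant by class field theory: files I–III of this series; this file only moves it to subfields of
`k̄` and `Γ_k`.)
[cite: Washington1997, §13.3 Lemmas 13.14–13.15 and Thm. 10.4 (proof)]
[cite: NeukirchANT1999, Ch. VI (6.9), (7.1) and Ch. IV §6 (equivariance of the Artin symbol)] -/
theorem equivariantHom_classGroup_eq_zero_of_cyclic_layer_absolute (p : ℕ) [Fact p.Prime]
    (hp2 : p ≠ 2) {B F : IntermediateField k (AlgebraicClosure k)} (hBF : B ≤ F)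
    [NumberField B] [NumberField F] [IsGalois k B] [IsGalois k F]
    (hdeg : Module.finrank k F = p * Module.finrank k B)
    (hcent : ∀ σ τ : absoluteGaloisGroup k, absRestrictNormalHom B σ = 1 →
      absRestrictNormalHom F (σ * τ) = absRestrictNormalHom F (τ * σ))
    {V : Type*} [AddCommGroup V] [DistribMulAction (absoluteGaloisGroup k) V]
    (hpV : ∀ v : V, p • v = 0)
    (hV : ∀ τ : absoluteGaloisGroup k, absRestrictNormalHom B τ = 1 → ∀ v : V, τ • v = v)
    (h0 : ∀ μ : Additive (ClassGroup (𝓞 B)) →+ V,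
      (∀ (τ : absoluteGaloisGroup k) (c : ClassGroup (𝓞 B)),
        μ (Additive.ofMul (ClassGroup.mulEquiv
          (AmbiguousClass.intAut (absRestrictNormalHom B τ)) c)) = τ • μ (Additive.ofMul c)) →
      μ = 0)
    (hD : ∀ (𝔓 : Ideal (𝓞 F)) [𝔓.IsMaximal],
      (∃ σ : absoluteGaloisGroup k, absRestrictNormalHom F σ ∈ 𝔓.inertia (F ≃ₐ[k] F) ∧
        absRestrictNormalHom F σ ≠ 1 ∧ absRestrictNormalHom B σ = 1) →
      ∀ v : V, (∀ τ : absoluteGaloisGroup k, absRestrictNormalHom F τ • 𝔓 = 𝔓 → τ • v = v) →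
        v = 0)
    (horb : ∃ (𝔓₀ : Ideal (𝓞 F)) (_ : 𝔓₀.IsMaximal),
      (∃ σ : absoluteGaloisGroup k, absRestrictNormalHom F σ ∈ 𝔓₀.inertia (F ≃ₐ[k] F) ∧
        absRestrictNormalHom F σ ≠ 1 ∧ absRestrictNormalHom B σ = 1) ∧
      ¬ p ∣ (MulAction.stabilizer (F ≃ₐ[k] F) 𝔓₀).index)
    (f : Additive (ClassGroup (𝓞 F)) →+ V)
    (hf : ∀ (τ : absoluteGaloisGroup k) (c : ClassGroup (𝓞 F)),
      f (Additive.ofMul (ClassGroup.mulEquiv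
        (AmbiguousClass.intAut (absRestrictNormalHom F τ)) c)) = τ • f (Additive.ofMul c)) :
    f = 0 := by
  classical
  have hp : p.Prime := Fact.out
  -- ### `B` as an intermediate field `Bi` of `F/k`, `eB : B ≃ₐ[k] Bi`
  set Bi : IntermediateField k F := IntermediateField.restrict hBF with hBidef
  set eB : B ≃ₐ[k] Bi := IntermediateField.restrict_algEquiv hBF with heBdef
  have heB : ∀ y : B, (((eB y : Bi) : F) : AlgebraicClosure k) = (y : AlgebraicClosure k) :=
    fun _ => rfl
  have hmemB : ∀ x : Bi, ((x : F) : AlgebraicClosure k) ∈ B := fun x => (mem_restrict hBF x.1).1 x.2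
  haveI : IsGalois k Bi := IsGalois.of_algEquiv eB
  set π : absoluteGaloisGroup k →* (F ≃ₐ[k] F) := absRestrictNormalHom F with hπdef
  have hπ : Function.Surjective π := absRestrictNormalHom_surjective' F
  have hval : ∀ (τ : absoluteGaloisGroup k) (x : F),
      ((π τ x : F) : AlgebraicClosure k) = τ • (x : AlgebraicClosure k) :=
    coe_absRestrictNormalHom_apply' F
  -- `τ|_B = 1 ↔ π τ fixes Bi pointwise`
  have hB1 : ∀ τ : absoluteGaloisGroup k,
      absRestrictNormalHom B τ = 1 ↔ ∀ x : Bi, π τ (x : F) = x := by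
    intro τ
    rw [absRestrictNormalHom_eq_one_iff']
    constructor
    · intro h x
      apply Subtype.ext
      rw [hval]
      exact h ⟨_, hmemB x⟩
    · intro h y
      have := congrArg (fun z : F => (z : AlgebraicClosure k)) (h (eB y))
      rwa [hval] at this
  -- ### degree `[F : Bi] = p`, `F/Bi` unramified at infinity
  have hdeg' : Module.finrank Bi F = p := by
    have h1 : Module.finrank k B = Module.finrank k Bi := eB.toLinearEquiv.finrank_eq
    have h2 := Module.finrank_mul_finrank k Bi F
    rw [← h1, hdeg, mul_comm p] at h2
    exact mul_left_cancel₀ (Module.finrank_pos (R := k) (M := B)).ne' h2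
  haveI : IsUnramifiedAtInfinitePlaces Bi F :=
    IsUnramifiedAtInfinitePlaces_of_odd_finrank (by rw [hdeg']; exact hp.odd_of_ne_two hp2)
  -- `#I(𝔓) = e(𝔓 | Bi)` in `Gal(F/Bi)`
  have hcardI : ∀ (𝔓 : Ideal (𝓞 F)) [𝔓.IsMaximal],
      Nat.card (𝔓.inertia (F ≃ₐ[Bi] F)) = 𝔓.ramificationIdx (𝓞 Bi) := fun 𝔓 _ =>
    card_inertia_eq_ramificationIdx F (F ≃ₐ[Bi] F) Bi 𝔓
  -- ### ramified over `Bi` ↔ the `Γ_k`-form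
  have hram_of : ∀ (𝔓 : Ideal (𝓞 F)) [𝔓.IsMaximal], 𝔓.ramificationIdx (𝓞 Bi) ≠ 1 →
      ∃ σ : absoluteGaloisGroup k, π σ ∈ 𝔓.inertia (F ≃ₐ[k] F) ∧ π σ ≠ 1 ∧
        absRestrictNormalHom B σ = 1 := by
    intro 𝔓 _ hne
    have hbot : 𝔓.inertia (F ≃ₐ[Bi] F) ≠ ⊥ := by
      intro h
      apply hne
      rw [← hcardI 𝔓, h, Subgroup.card_bot]
    obtain ⟨σ, hσI, hσ1⟩ := (Subgroup.bot_or_exists_ne_one _).resolve_left hbot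
    obtain ⟨σ', hσ'⟩ := hπ (σ.restrictScalars k)
    refine ⟨σ', ?_, ?_, ?_⟩
    · rw [hσ']
      exact fun x => hσI x
    · rw [hσ']
      intro h
      apply hσ1
      exact AlgEquiv.ext fun x => congrArg (fun g : F ≃ₐ[k] F => g x) h
    · refine (hB1 σ').mpr fun x => ?_
      rw [hσ']
      exact σ.commutes x
  have hof_ram : ∀ (𝔓 : Ideal (𝓞 F)) [𝔓.IsMaximal],
      (∃ σ : absoluteGaloisGroup k, π σ ∈ 𝔓.inertia (F ≃ₐ[k] F) ∧ π σ ≠ 1 ∧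
        absRestrictNormalHom B σ = 1) → 𝔓.ramificationIdx (𝓞 Bi) ≠ 1 := by
    rintro 𝔓 _ ⟨σ', hI, hne, hB⟩ h1
    have hmem : π σ' ∈ Bi.fixingSubgroup :=
      (IntermediateField.mem_fixingSubgroup_iff _ _).mpr fun x hx => (hB1 σ').mp hB ⟨x, hx⟩
    set σ : F ≃ₐ[Bi] F := IntermediateField.fixingSubgroupEquiv Bi ⟨π σ', hmem⟩ with hσdef
    have hσI : σ ∈ 𝔓.inertia (F ≃ₐ[Bi] F) := fun x => hI x
    have hbot : 𝔓.inertia (F ≃ₐ[Bi] F) = ⊥ := by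
      rw [← Subgroup.card_eq_one, hcardI 𝔓, h1]
    rw [hbot, Subgroup.mem_bot] at hσI
    apply hne
    exact AlgEquiv.ext fun x => congrArg (fun g : F ≃ₐ[Bi] F => g x) hσI
  -- ### apply file III with `B := Bi`
  refine equivariantHom_classGroup_eq_zero_of_cyclic_layer_of_classGroup (k := k) (B := Bi) (F := F)
    p hdeg' ?_ π hπ hpV ?_ ?_ ?_ ?_ f hf
  · -- `Gal(F/Bi)` central
    intro σ τ x
    obtain ⟨σ', hσ'⟩ := hπ (σ.restrictScalars k)
    obtain ⟨τ', rfl⟩ := hπ τ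
    have hB : absRestrictNormalHom B σ' = 1 :=
      (hB1 σ').mpr fun y => by rw [hσ']; exact σ.commutes y
    have h := hcent σ' τ' hB
    rw [map_mul, map_mul, hσ'] at h
    have hx := congrArg (fun g : F ≃ₐ[k] F => g x) h
    simpa only [AlgEquiv.mul_apply, AlgEquiv.restrictScalars_apply] using hx.symm
  · -- `Γ_{Bi}` acts trivially
    intro τ hτ
    exact hV τ ((hB1 τ).mpr fun x => hτ x)
  · -- (c2*) for `Bi`, transported along `eB`
    intro μ hμ
    set gB : 𝓞 B ≃+* 𝓞 Bi := RingOfIntegers.mapRingEquiv eB.toRingEquiv with hgBdef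
    set eCl : ClassGroup (𝓞 B) ≃* ClassGroup (𝓞 Bi) := ClassGroup.mulEquiv gB with heCldef
    set μ' : Additive (ClassGroup (𝓞 B)) →+ V :=
      AddMonoidHom.mk' (fun a => μ (Additive.ofMul (eCl (Additive.toMul a))))
        (fun a b => by simp only [toMul_add, map_mul, ofMul_mul, map_add]) with hμ'def
    have hμ'apply : ∀ c : ClassGroup (𝓞 B),
        μ' (Additive.ofMul c) = μ (Additive.ofMul (eCl c)) := fun _ => rfl
    -- compatibility of `gB`, `eCl` with the two Galois actions
    have hgcomp : ∀ τ : absoluteGaloisGroup k,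
        (gB : 𝓞 B →+* 𝓞 Bi).comp (AmbiguousClass.intAut (absRestrictNormalHom B τ) : 𝓞 B →+* 𝓞 B) =
          (AmbiguousClass.intAut ((π τ).restrictNormal Bi) : 𝓞 Bi →+* 𝓞 Bi).comp
            (gB : 𝓞 B →+* 𝓞 Bi) := by
      intro τ
      refine RingHom.ext fun y => Subtype.ext <| Subtype.ext <| Subtype.ext ?_
      change (((eB (absRestrictNormalHom B τ (y : B)) : Bi) : F) : AlgebraicClosure k) =
        ((algebraMap Bi F (((π τ).restrictNormal Bi) (eB (y : B))) : F) : AlgebraicClosure k)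
      rw [AlgEquiv.restrictNormal_commutes, heB, coe_absRestrictNormalHom_apply' B, hval]
      rfl
    have hcomp : ∀ (τ : absoluteGaloisGroup k) (c : ClassGroup (𝓞 B)),
        eCl (ClassGroup.mulEquiv (AmbiguousClass.intAut (absRestrictNormalHom B τ)) c) =
          ClassGroup.mulEquiv (AmbiguousClass.intAut ((π τ).restrictNormal Bi)) (eCl c) := by
      intro τ c
      obtain ⟨J, rfl⟩ := ClassGroup.mk0_surjective c
      rw [AmbiguousClass.mulEquiv_mk0, heCldef, mulEquiv_mk0', mulEquiv_mk0',
        AmbiguousClass.mulEquiv_mk0]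
      congr 1
      apply Subtype.ext
      change ((J : Ideal (𝓞 B)).map _).map _ = ((J : Ideal (𝓞 B)).map _).map _
      rw [Ideal.map_map, Ideal.map_map, hgcomp]
    have hμ' : μ' = 0 := by
      refine h0 μ' fun τ c => ?_
      rw [hμ'apply, hμ'apply, hcomp]
      exact hμ τ (eCl c)
    refine AddMonoidHom.ext fun a => ?_
    obtain ⟨c, rfl⟩ : ∃ c : ClassGroup (𝓞 Bi), Additive.ofMul c = a := ⟨Additive.toMul a, rfl⟩
    have h := congrArg (fun ν : Additive (ClassGroup (𝓞 B)) →+ V => ν (Additive.ofMul (eCl.symm c))) hμ'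
    simpa only [hμ'apply, MulEquiv.apply_symm_apply, AddMonoidHom.zero_apply] using h
  · -- (c3*)
    intro 𝔓 _ hne v hv
    exact hD 𝔓 (hram_of 𝔓 hne) v hv
  · -- one ramified orbit prime to `p`
    obtain ⟨𝔓₀, h𝔓₀, hram, hidx⟩ := horb
    exact ⟨𝔓₀, h𝔓₀, hof_ram 𝔓₀ hram, hidx⟩

/-! ### The tower -/

/-- A homomorphism from a finite abelian group of order prime to `p` to a `p`-torsion group is zero.
[folklore] -/
private theorem addMonoidHom_eq_zero_of_not_dvd_card {G : Type*} [CommGroup G] [Finite G] {p : ℕ}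
    (hp : p.Prime) (hG : ¬ p ∣ Nat.card G) {V : Type*} [AddCommGroup V] (hpV : ∀ v : V, p • v = 0)
    (μ : Additive G →+ V) : μ = 0 := by
  refine AddMonoidHom.ext fun a => ?_
  have ha : Nat.card G • a = 0 := by
    rw [← ofMul_toMul a, ← ofMul_pow, pow_card_eq_one', ofMul_one]
  have h1 : ((Nat.card G : ℕ) : ℤ) • μ a = 0 := by
    rw [natCast_zsmul, ← map_nsmul, ha, map_zero]
  have h2 : ((p : ℕ) : ℤ) • μ a = 0 := by rw [natCast_zsmul, hpV]
  have hcop : IsCoprime (Nat.card G : ℤ) (p : ℤ) :=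
    Nat.isCoprime_iff_coprime.mpr (Nat.coprime_comm.mp ((Nat.Prime.coprime_iff_not_dvd hp).mpr hG))
  obtain ⟨u, v, huv⟩ := hcop
  have h : (u * (Nat.card G : ℤ) + v * (p : ℤ)) • μ a = 0 := by
    rw [add_smul, mul_smul, mul_smul, h1, h2, smul_zero, smul_zero, add_zero]
  rwa [huv, one_smul] at h

/-- **The equivariant Iwasawa lemma along a tower.**  `k` a number field, `p` an odd prime,
`L₀ ≤ L₁ ≤ L₂ ≤ ⋯` finite Galois subextensions of `k̄/k` with `[L_{n+1} : k] = p · [L_n : k]` and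
`Gal(L_{n+1}/L_n)` central in `Gal(L_{n+1}/k)`; `V` a `p`-torsion `Γ_k`-module on which `Γ_{L₀}` acts
trivially; for every `n`, (c3*)ₙ the decomposition groups in `Γ_k` of the primes of `L_{n+1}` ramified over
`L_n` have no non-zero fixed vector on `V`, and one such prime has a number of `Gal(L_{n+1}/k)`-conjugates
prime to `p`.  If (c2*) every additive `Γ_k`-equivariant `Cl(𝓞_{L₀}) → V` is zero, then for every `n`
every additive `Γ_k`-equivariant `Cl(𝓞_{L_n}) → V` is zero (induction on `n` with
`equivariantHom_classGroup_eq_zero_of_cyclic_layer_absolute`).  With `k = ℚ`, `V = E[p]` and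
`L_n = ℚ(E[p])ℚ_n` this is «the `E[p]`-part of the class group never appears in the cyclotomic tower»,
the isotypic refinement of Iwasawa's theorem `p ∤ h(K) ⟹ p ∤ h(K_n)` (Washington Thm. 10.4 / §13.3).
[cite: Washington1997, §13.3 Lemmas 13.14–13.15 and Thm. 10.4 (proof)]
[cite: NeukirchANT1999, Ch. VI (6.9), (7.1) and Ch. IV §6 (equivariance of the Artin symbol)] -/
theorem equivariantHom_classGroup_eq_zero_tower (p : ℕ) [Fact p.Prime] (hp2 : p ≠ 2)
    (L : ℕ → IntermediateField k (AlgebraicClosure k)) (hmono : ∀ n, L n ≤ L (n + 1))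
    [hNF : ∀ n, NumberField (L n)] [hGal : ∀ n, IsGalois k (L n)]
    (hdeg : ∀ n, Module.finrank k (L (n + 1)) = p * Module.finrank k (L n))
    (hcent : ∀ (n : ℕ) (σ τ : absoluteGaloisGroup k), absRestrictNormalHom (L n) σ = 1 →
      absRestrictNormalHom (L (n + 1)) (σ * τ) = absRestrictNormalHom (L (n + 1)) (τ * σ))
    {V : Type*} [AddCommGroup V] [DistribMulAction (absoluteGaloisGroup k) V]
    (hpV : ∀ v : V, p • v = 0)
    (hV : ∀ τ : absoluteGaloisGroup k, absRestrictNormalHom (L 0) τ = 1 → ∀ v : V, τ • v = v)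
    (hD : ∀ (n : ℕ) (𝔓 : Ideal (𝓞 (L (n + 1)))) [𝔓.IsMaximal],
      (∃ σ : absoluteGaloisGroup k,
        absRestrictNormalHom (L (n + 1)) σ ∈ 𝔓.inertia (L (n + 1) ≃ₐ[k] L (n + 1)) ∧
        absRestrictNormalHom (L (n + 1)) σ ≠ 1 ∧ absRestrictNormalHom (L n) σ = 1) →
      ∀ v : V, (∀ τ : absoluteGaloisGroup k,
        absRestrictNormalHom (L (n + 1)) τ • 𝔓 = 𝔓 → τ • v = v) → v = 0)
    (horb : ∀ n : ℕ, ∃ (𝔓₀ : Ideal (𝓞 (L (n + 1)))) (_ : 𝔓₀.IsMaximal),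
      (∃ σ : absoluteGaloisGroup k,
        absRestrictNormalHom (L (n + 1)) σ ∈ 𝔓₀.inertia (L (n + 1) ≃ₐ[k] L (n + 1)) ∧
        absRestrictNormalHom (L (n + 1)) σ ≠ 1 ∧ absRestrictNormalHom (L n) σ = 1) ∧
      ¬ p ∣ (MulAction.stabilizer (L (n + 1) ≃ₐ[k] L (n + 1)) 𝔓₀).index)
    (h0 : ∀ μ : Additive (ClassGroup (𝓞 (L 0))) →+ V,
      (∀ (τ : absoluteGaloisGroup k) (c : ClassGroup (𝓞 (L 0))),
        μ (Additive.ofMul (ClassGroup.mulEquiv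
          (AmbiguousClass.intAut (absRestrictNormalHom (L 0) τ)) c)) = τ • μ (Additive.ofMul c)) →
      μ = 0)
    (n : ℕ) (f : Additive (ClassGroup (𝓞 (L n))) →+ V)
    (hf : ∀ (τ : absoluteGaloisGroup k) (c : ClassGroup (𝓞 (L n))),
      f (Additive.ofMul (ClassGroup.mulEquiv
        (AmbiguousClass.intAut (absRestrictNormalHom (L n) τ)) c)) = τ • f (Additive.ofMul c)) :
    f = 0 := by
  induction n with
  | zero => exact h0 f hf
  | succ n ih =>
    have hle : L 0 ≤ L n := (monotone_nat_of_le_succ hmono) (Nat.zero_le n)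
    exact equivariantHom_classGroup_eq_zero_of_cyclic_layer_absolute p hp2 (hmono n) (hdeg n)
      (hcent n) hpV (fun τ hτ => hV τ (absRestrictNormalHom_eq_one_of_le hle τ hτ))
      (fun μ hμ => ih μ hμ) (fun 𝔓 _ => hD n 𝔓) (horb n) f hf

/-- **The tower from `p ∤ h(L₀)`.**  As `equivariantHom_classGroup_eq_zero_tower`, with (c2*) at the
bottom replaced by `p ∤ #Cl(𝓞_{L₀})` (then every additive `Cl(𝓞_{L₀}) → V` is zero, `V` being
`p`-torsion): for every `n`, every additive `Γ_k`-equivariant `Cl(𝓞_{L_n}) → V` vanishes.  (Iwasawa's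
`p ∤ h(K) ⟹ p ∤ h(K_n)`, Washington Thm. 10.4 / §13.3, refined to a `Γ_k`-module `V`.)
[cite: Washington1997, §13.3 Lemmas 13.14–13.15 and Thm. 10.4 (proof)]
[cite: NeukirchANT1999, Ch. VI (6.9), (7.1) and Ch. IV §6 (equivariance of the Artin symbol)] -/
theorem equivariantHom_classGroup_eq_zero_tower_of_not_dvd_card (p : ℕ) [Fact p.Prime] (hp2 : p ≠ 2)
    (L : ℕ → IntermediateField k (AlgebraicClosure k)) (hmono : ∀ n, L n ≤ L (n + 1))
    [hNF : ∀ n, NumberField (L n)] [hGal : ∀ n, IsGalois k (L n)]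
    (hdeg : ∀ n, Module.finrank k (L (n + 1)) = p * Module.finrank k (L n))
    (hcent : ∀ (n : ℕ) (σ τ : absoluteGaloisGroup k), absRestrictNormalHom (L n) σ = 1 →
      absRestrictNormalHom (L (n + 1)) (σ * τ) = absRestrictNormalHom (L (n + 1)) (τ * σ))
    {V : Type*} [AddCommGroup V] [DistribMulAction (absoluteGaloisGroup k) V]
    (hpV : ∀ v : V, p • v = 0)
    (hV : ∀ τ : absoluteGaloisGroup k, absRestrictNormalHom (L 0) τ = 1 → ∀ v : V, τ • v = v)
    (hD : ∀ (n : ℕ) (𝔓 : Ideal (𝓞 (L (n + 1)))) [𝔓.IsMaximal],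
      (∃ σ : absoluteGaloisGroup k,
        absRestrictNormalHom (L (n + 1)) σ ∈ 𝔓.inertia (L (n + 1) ≃ₐ[k] L (n + 1)) ∧
        absRestrictNormalHom (L (n + 1)) σ ≠ 1 ∧ absRestrictNormalHom (L n) σ = 1) →
      ∀ v : V, (∀ τ : absoluteGaloisGroup k,
        absRestrictNormalHom (L (n + 1)) τ • 𝔓 = 𝔓 → τ • v = v) → v = 0)
    (horb : ∀ n : ℕ, ∃ (𝔓₀ : Ideal (𝓞 (L (n + 1)))) (_ : 𝔓₀.IsMaximal),
      (∃ σ : absoluteGaloisGroup k,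
        absRestrictNormalHom (L (n + 1)) σ ∈ 𝔓₀.inertia (L (n + 1) ≃ₐ[k] L (n + 1)) ∧
        absRestrictNormalHom (L (n + 1)) σ ≠ 1 ∧ absRestrictNormalHom (L n) σ = 1) ∧
      ¬ p ∣ (MulAction.stabilizer (L (n + 1) ≃ₐ[k] L (n + 1)) 𝔓₀).index)
    (h0 : ¬ p ∣ Nat.card (ClassGroup (𝓞 (L 0))))
    (n : ℕ) (f : Additive (ClassGroup (𝓞 (L n))) →+ V)
    (hf : ∀ (τ : absoluteGaloisGroup k) (c : ClassGroup (𝓞 (L n))),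
      f (Additive.ofMul (ClassGroup.mulEquiv
        (AmbiguousClass.intAut (absRestrictNormalHom (L n) τ)) c)) = τ • f (Additive.ofMul c)) :
    f = 0 :=
  equivariantHom_classGroup_eq_zero_tower p hp2 L hmono hdeg hcent hpV hV hD horb
    (fun μ _ => addMonoidHom_eq_zero_of_not_dvd_card (Fact.out : p.Prime) h0 hpV μ) n f hf

end Absolute

end EquivariantIwasawaLemma

end Literature.NumberTheory.NumberFields

end
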